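import Literature.NumberTheory.EllipticCurves.HeegnerGeomCoherentPointIdentitiesProofs
import HarnessLib

/-!
# Characters of `Γ_K` that factor through a `ℤ_p`-extension: when they kill a layer, when they do not kill
# `γ^{p^j}`; `p^k`-term transversals `{γ^i}_{i<p^k}` of `Gal(K̄/K_k)` and product transversals (proofs file)

Topic `NumberTheory/EllipticCurves`. THEOREMS ONLY (no definition, no named fact, no `sorry`, no instance).
Written by the cell `bsd-print-x9`, seat `bsd-line-x9-p1-w2` (g14), as brick F2 of the deduction
«Cornut–Vatsal 2007 Thm. 1.10 ⇒ the `Λ`-adic stabilised Heegner class `κ_∞` of the coherent CGLS datum is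
non-zero» (write-crux stmt-BirchSwinnertonDyer-25235). Cornut–Vatsal's theorem (tree fact
`CornutVatsal2007.thm110_exists_heegnerCharSum_ne_zero`) hands out an anticyclotomic character `φ : Γ_K → ℂˣ` of
finite order which is trivial on `Gal(K̄/K[p^n])` and non-trivial on `Gal(K̄/K[p^{n-1}])`, together with the
non-vanishing of a character sum over a transversal of `Gal(K̄/K[p^n])` in `Γ_K`; to compare this with the norm
points `u_k = Σ_{a ∈ A_k} a • P[p^{d(k)}]` of the CGLS datum (`A_k` a transversal INSIDE `Gal(K̄/K_k)`) one needs the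
elementary `κ`-arithmetic below (`Gal(K̄/K_k) = κ⁻¹(p^k ℤ_p)`, `κ γ = 1`).

WHAT (for a `ℤ_p`-extension `κ` with topological generator `γ`; `φ : Γ_K →* M` any monoid-valued character).
* §1 `exists_pow_inv_mul_mem_layerSubgroup`: if `σ₀ ∈ Gal(K̄/K_k) ∖ Gal(K̄/K_{k+1})` then every `σ ∈ Gal(K̄/K_k)` is
  `σ₀^n · η` with `η ∈ Gal(K̄/K_{k'})`, for any `k'` (`κ σ₀ = p^k·unit`); hence
  **`apply_eq_one_of_le_layerSubgroup_of_not_le`**: a character trivial on some layer subgroup `Gal(K̄/K_{k'})`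
  and on a subgroup `R` with `R ≤ Gal(K̄/K_k)`, `R ⊄ Gal(K̄/K_{k+1})` (e.g. `R = Gal(K̄/K[p^{d(k)}])`) is trivial on
  `Gal(K̄/K_k)`.
* §1 **`apply_topGenerator_pow_ne_one`**: a character trivial on `Gal(K̄/K_{j+1})` but not at some
  `σ' ∈ Gal(K̄/K_j)` is not trivial at `γ^{p^j}` (`{γ^{p^j i}}_{i<p}` is a transversal, tree lemma
  `ZpExtension.existsUnique_topGenerator_pow`); `apply_topGenerator_pow_succ_eq_one`.
* §2 **`existsUnique_topGenerator_pow_of_lt`**: `{γ^i : i < p^k}` is a transversal of `Gal(K̄/K_k)` in `Γ_K`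
  (`PadicInt.appr`, `PadicInt.zmod_congr_of_sub_mem_span`).
* §3 (pure group theory) **`existsUnique_mul_of_transversal`** / `injOn_mul_of_transversal`: if `S` is a
  transversal of `Mid` in `Γ` and `A ⊆ Mid` one of `H ≤ Mid` in `Mid`, then `S·A` (image of the product) is a
  transversal of `H` in `Γ` and `(s, a) ↦ s a` is injective on `S × A` (the argument inside the tree's
  `sum_smul_eq_sum_sum_smul`, exported).
HONEST FRAMING: elementary bookkeeping; nothing about any curve; «beyond-print theorem»: no; BSD is not proved by
any of this.

References: [Washington1997] §13.1 (`Gal(K_∞/K_n) = p^n ℤ_p`, topologically generated by `γ^{p^n}`);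
[CornutVatsal2007] §1.1 (ring class characters, `G(∞)/G₀ ≅ ℤ_p`) and p. 158 (`P(n, χ₀)`).
-/

set_option autoImplicit false

noncomputable section

open scoped Classical

namespace Literature.NumberTheory.EllipticCurves

namespace ZpExtension

variable {K : Type} [Field K] {p : ℕ} [Fact p.Prime] (κ : ZpExtension K p)

/-! ## §1 Characters killing a layer -/

/-- **`Gal(K̄/K_k) = σ₀^ℕ · Gal(K̄/K_{k'})` for any `σ₀ ∈ Gal(K̄/K_k) ∖ Gal(K̄/K_{k+1})`**: `κ σ₀ = p^k u` with `u` a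
unit, `κ σ = p^k t`, and `n ≡ t u⁻¹ (mod p^{k'})` gives `κ(σ₀^{-n} σ) ∈ p^{k'} ℤ_p`.
[cite: Washington1997, §13.1 (Gal(K_∞/K_n) = p^n ℤ_p)] -/
theorem exists_pow_inv_mul_mem_layerSubgroup {k : ℕ} {σ₀ : Field.absoluteGaloisGroup K}
    (h₀ : σ₀ ∈ κ.layerSubgroup k) (h₀' : σ₀ ∉ κ.layerSubgroup (k + 1)) (k' : ℕ)
    {σ : Field.absoluteGaloisGroup K} (hσ : σ ∈ κ.layerSubgroup k) :
    ∃ n : ℕ, (σ₀ ^ n)⁻¹ * σ ∈ κ.layerSubgroup k' := by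
  have hp : p.Prime := Fact.out
  rw [mem_layerSubgroup] at h₀ hσ
  obtain ⟨u, hu⟩ := h₀
  obtain ⟨t, ht⟩ := hσ
  -- `u` is a unit: otherwise `p ∣ u` and `σ₀ ∈ Gal(K̄/K_{k+1})`
  have hunit : IsUnit u := by
    by_contra hnu
    apply h₀'
    rw [mem_layerSubgroup, hu, pow_succ]
    exact mul_dvd_mul_left _ ((PadicInt.norm_lt_one_iff_dvd u).mp (PadicInt.not_isUnit_iff.mp hnu))
  obtain ⟨w, huw⟩ := hunit.exists_right_inv
  set n : ℕ := (t * w).appr k' with hn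
  have hspec := PadicInt.appr_spec k' (t * w)
  rw [Ideal.mem_span_singleton] at hspec
  obtain ⟨r, hr⟩ := hspec
  refine ⟨n, ?_⟩
  rw [mem_layerSubgroup, map_mul, map_inv, map_pow, toAdd_mul, toAdd_inv, toAdd_pow, hu, ht]
  refine ⟨(p : ℤ_[p]) ^ k * u * r, ?_⟩
  rw [nsmul_eq_mul]
  linear_combination ((p : ℤ_[p]) ^ k * u) * hr - ((p : ℤ_[p]) ^ k * t) * huw

/-- **A character that kills SOME layer subgroup and a subgroup `R ≤ Gal(K̄/K_k)` NOT contained in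
`Gal(K̄/K_{k+1})` kills `Gal(K̄/K_k)`** (every element of `Gal(K̄/K_k)` is `σ₀^n η` with `σ₀ ∈ R`, `η` in the killed
layer). Used with `R = Gal(K̄/K[p^{d(k)}])` (the CGLS shift: `K_k ⊆ K[p^{d(k)}]`, `K_{k+1} ⊄ K[p^{d(k)}]`) and a
finite-order anticyclotomic character of conductor `p^{d(k)}`.
[cite: CornutVatsal2007, §1.1 and p. 158 (P(n, χ₀): characters of G(n) inducing χ₀ on G₀)] [cite: Washington1997, §13.1] -/
theorem apply_eq_one_of_le_layerSubgroup_of_not_le {M : Type*} [Monoid M]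
    (φ : Field.absoluteGaloisGroup K →* M) {k' : ℕ} (hφk' : ∀ σ ∈ κ.layerSubgroup k', φ σ = 1)
    {R : Subgroup (Field.absoluteGaloisGroup K)} (hφR : ∀ σ ∈ R, φ σ = 1) {k : ℕ}
    (hRk : R ≤ κ.layerSubgroup k) (hRnot : ¬ R ≤ κ.layerSubgroup (k + 1)) :
    ∀ σ ∈ κ.layerSubgroup k, φ σ = 1 := by
  obtain ⟨σ₀, hσ₀R, hσ₀'⟩ := Set.not_subset.mp hRnot
  intro σ hσ
  obtain ⟨n, hn⟩ := κ.exists_pow_inv_mul_mem_layerSubgroup (hRk hσ₀R) hσ₀' k' hσ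
  have hdecomp : σ = σ₀ ^ n * ((σ₀ ^ n)⁻¹ * σ) := by rw [mul_inv_cancel_left]
  rw [hdecomp, map_mul, map_pow, hφR σ₀ hσ₀R, one_pow, one_mul, hφk' _ hn]

/-- **A character killing `Gal(K̄/K_{j+1})` but not some `σ' ∈ Gal(K̄/K_j)` does not kill `γ^{p^j}`**
(`σ' ∈ γ^{p^j i} · Gal(K̄/K_{j+1})` for some `i < p`, `ZpExtension.existsUnique_topGenerator_pow`).
[cite: Washington1997, §13.1 (Gal(K_{n+1}/K_n) ≅ ℤ/p generated by γ^{p^n})] -/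
theorem apply_topGenerator_pow_ne_one {M : Type*} [Monoid M] (φ : Field.absoluteGaloisGroup K →* M)
    {γ : Field.absoluteGaloisGroup K} (hγ : κ.IsTopGenerator γ) {j : ℕ}
    (hφ : ∀ σ ∈ κ.layerSubgroup (j + 1), φ σ = 1) {σ' : Field.absoluteGaloisGroup K}
    (hσ' : σ' ∈ κ.layerSubgroup j) (hne : φ σ' ≠ 1) : φ (γ ^ p ^ j) ≠ 1 := by
  intro h1
  obtain ⟨a, ⟨ha, haσ⟩, -⟩ := κ.existsUnique_topGenerator_pow hγ j σ' hσ'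
  obtain ⟨i, -, rfl⟩ := Finset.mem_image.mp ha
  apply hne
  have hdecomp : σ' = γ ^ (p ^ j * i) * ((γ ^ (p ^ j * i))⁻¹ * σ') := by rw [mul_inv_cancel_left]
  rw [hdecomp, map_mul, hφ _ haσ, mul_one, pow_mul, map_pow, h1, one_pow]

/-- A character killing `Gal(K̄/K_{j+1})` kills `(γ^{p^j})^p = γ^{p^{j+1}}`. [cite: Washington1997, §13.1] -/
theorem apply_topGenerator_pow_succ_eq_one {M : Type*} [Monoid M] (φ : Field.absoluteGaloisGroup K →* M)
    {γ : Field.absoluteGaloisGroup K} (hγ : κ.IsTopGenerator γ) {j : ℕ}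
    (hφ : ∀ σ ∈ κ.layerSubgroup (j + 1), φ σ = 1) : φ (γ ^ p ^ j) ^ p = 1 := by
  rw [← map_pow, ← pow_mul, ← pow_succ]
  have h := κ.topGenerator_pow_mem_layerSubgroup hγ (j + 1) 1
  rw [mul_one] at h
  exact hφ _ h

/-- A character killing `Gal(K̄/K_k)` kills `γ^{p^k}`. [cite: Washington1997, §13.1] -/
theorem apply_topGenerator_pow_eq_one {M : Type*} [Monoid M] (φ : Field.absoluteGaloisGroup K →* M)
    {γ : Field.absoluteGaloisGroup K} (hγ : κ.IsTopGenerator γ) {k : ℕ}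
    (hφ : ∀ σ ∈ κ.layerSubgroup k, φ σ = 1) : φ (γ ^ p ^ k) = 1 := by
  have h := κ.topGenerator_pow_mem_layerSubgroup hγ k 1
  rw [mul_one] at h
  exact hφ _ h

/-! ## §2 The transversal `{γ^i : i < p^k}` of `Gal(K̄/K_k)` in `Γ_K` -/

/-- **`{γ^i : i < p^k}` is a transversal of `Gal(K̄/K_k)` in `Γ_K`**: `τ ∈ γ^i Gal(K̄/K_k)` iff
`κ τ ≡ i (mod p^k)`, and `i = appr (κ τ) k` is the unique such `i < p^k`.
[cite: Washington1997, §13.1 (Gal(K_n/K) ≅ ℤ/p^n generated by γ)] -/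
theorem existsUnique_topGenerator_pow_of_lt {γ : Field.absoluteGaloisGroup K} (hγ : κ.IsTopGenerator γ)
    (k : ℕ) (τ : Field.absoluteGaloisGroup K) :
    ∃! s, s ∈ (Finset.range (p ^ k)).image (fun i : ℕ ↦ γ ^ i) ∧ s⁻¹ * τ ∈ κ.layerSubgroup k := by
  set t : ℤ_[p] := (κ τ).toAdd with ht
  -- membership criterion for `(γ^i)⁻¹ τ`
  have hcrit : ∀ i : ℕ, (γ ^ i)⁻¹ * τ ∈ κ.layerSubgroup k ↔ t - i ∈ Ideal.span {(p : ℤ_[p]) ^ k} := by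
    intro i
    rw [mem_layerSubgroup, map_mul, map_inv, map_pow, toAdd_mul, toAdd_inv, toAdd_pow, hγ, toAdd_ofAdd,
      nsmul_eq_mul, mul_one, Ideal.mem_span_singleton, ← ht, show -(i : ℤ_[p]) + t = t - i by ring]
  refine ⟨γ ^ t.appr k, ⟨Finset.mem_image.mpr ⟨t.appr k, Finset.mem_range.mpr (PadicInt.appr_lt t k), rfl⟩,
    (hcrit _).mpr (PadicInt.appr_spec k t)⟩, ?_⟩
  rintro s ⟨hs, hsτ⟩
  obtain ⟨i, hi, rfl⟩ := Finset.mem_image.mp hs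
  have hcongr : ((t.appr k : ℕ) : ZMod (p ^ k)) = (i : ZMod (p ^ k)) :=
    PadicInt.zmod_congr_of_sub_mem_span k t _ _ (PadicInt.appr_spec k t) ((hcrit i).mp hsτ)
  have hik : i = t.appr k := by
    have h := (ZMod.natCast_eq_natCast_iff' _ _ _).mp hcongr
    rw [Nat.mod_eq_of_lt (PadicInt.appr_lt t k), Nat.mod_eq_of_lt (Finset.mem_range.mp hi)] at h
    exact h.symm
  rw [hik]

/-- The enumeration `i ↦ γ^i` is injective on `{0, …, p^k − 1}` (`κ(γ^i) = i`).
[cite: Washington1997, §13.1] -/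
theorem topGenerator_pow_injOn_range {γ : Field.absoluteGaloisGroup K} (hγ : κ.IsTopGenerator γ) (k : ℕ) :
    Set.InjOn (fun i : ℕ ↦ γ ^ i) ↑(Finset.range (p ^ k)) := by
  intro i hi i' hi' h
  have hu := κ.existsUnique_topGenerator_pow_of_lt hγ k (γ ^ i)
  have hmem : ∀ j : ℕ, γ ^ j = γ ^ i → (γ ^ j)⁻¹ * γ ^ i ∈ κ.layerSubgroup k := fun j hj ↦ by
    rw [hj, inv_mul_cancel]; exact (κ.layerSubgroup k).one_mem
  have h1 := hu.unique ⟨Finset.mem_image.mpr ⟨i, hi, rfl⟩, hmem i rfl⟩ ⟨Finset.mem_image.mpr ⟨i', hi', rfl⟩, hmem i' h.symm⟩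
  -- `γ^i = γ^{i'}` with `κ(γ^i) = i` in the domain `ℤ_p`
  have h' := congrArg (fun g ↦ (κ g).toAdd) h1
  simp only [map_pow, toAdd_pow, nsmul_eq_mul] at h'
  have hγ1 : Multiplicative.toAdd (κ γ) = 1 := by rw [hγ]; rfl
  rw [hγ1, mul_one, mul_one] at h'
  exact_mod_cast h'

end ZpExtension

/-! ## §3 Product transversals (pure group theory) -/

section Transversal

variable {Γ : Type*} [Group Γ]

/-- **`(s, a) ↦ s a` is injective on `S × A`** when `S` is a transversal of `Mid` in `Γ` and `A ⊆ Mid` (two products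
`s a = s' a'` lie in the same `Mid`-coset, so `s = s'`). [cite: Howard2004HeegnerKolyvagin, §3.3 (Norm_{K[c']/K_n} = Norm_{K[c]K_n/K_n} ∘ Norm)] -/
theorem injOn_mul_of_transversal {Mid : Subgroup Γ} {S A : Finset Γ}
    (htS : ∀ τ : Γ, ∃! s, s ∈ S ∧ s⁻¹ * τ ∈ Mid) (hA : ∀ a ∈ A, a ∈ Mid) :
    Set.InjOn (fun q : Γ × Γ ↦ q.1 * q.2) ↑(S ×ˢ A) := by
  rintro ⟨s, a⟩ hq ⟨s', a'⟩ hq' (h : s * a = s' * a')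
  rw [Finset.mem_coe, Finset.mem_product] at hq hq'
  have hsM : s⁻¹ * (s' * a') ∈ Mid := by
    rw [← h, inv_mul_cancel_left]; exact hA a hq.2
  have hs'M : s'⁻¹ * (s' * a') ∈ Mid := by
    rw [inv_mul_cancel_left]; exact hA a' hq'.2
  have hss' : s = s' := (htS (s' * a')).unique ⟨hq.1, hsM⟩ ⟨hq'.1, hs'M⟩
  subst hss'
  have haa' : a = a' := mul_left_cancel h
  subst haa'
  rfl

/-- **The product of a transversal `S` of `Mid` in `Γ` and a transversal `A ⊆ Mid` of `H ≤ Mid` in `Mid` is a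
transversal of `H` in `Γ`** (`S·A`, as the image of `S × A` under multiplication).
[cite: Howard2004HeegnerKolyvagin, §3.3 (Norm_{K[c']/K_n} = Norm_{K[c]K_n/K_n} ∘ Norm_{K[c']/K[c]K_n})] [cite: PerrinRiou1987BSMF, §3.3] -/
theorem existsUnique_mul_of_transversal {Mid H : Subgroup Γ} (hHM : H ≤ Mid) {S A : Finset Γ}
    (htS : ∀ τ : Γ, ∃! s, s ∈ S ∧ s⁻¹ * τ ∈ Mid) (hA : ∀ a ∈ A, a ∈ Mid)
    (htA : ∀ μ ∈ Mid, ∃! a, a ∈ A ∧ a⁻¹ * μ ∈ H) (τ : Γ) :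
    ∃! r, r ∈ (S ×ˢ A).image (fun q : Γ × Γ ↦ q.1 * q.2) ∧ r⁻¹ * τ ∈ H := by
  obtain ⟨s, ⟨hsS, hsτ⟩, hsuniq⟩ := htS τ
  obtain ⟨a, ⟨haA, haτ⟩, hauniq⟩ := htA (s⁻¹ * τ) hsτ
  refine ⟨s * a, ⟨Finset.mem_image.mpr ⟨(s, a), Finset.mem_product.mpr ⟨hsS, haA⟩, rfl⟩, ?_⟩, ?_⟩
  · rwa [mul_inv_rev, mul_assoc]
  · rintro r ⟨hr, hrτ⟩
    obtain ⟨⟨s', a'⟩, hq, rfl⟩ := Finset.mem_image.mp hr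
    rw [Finset.mem_product] at hq
    change s' * a' = s * a
    have h1 : (s' * a')⁻¹ * τ ∈ Mid := hHM hrτ
    have hs'τ : s'⁻¹ * τ ∈ Mid := by
      have : s'⁻¹ * τ = a' * ((s' * a')⁻¹ * τ) := by
        rw [mul_inv_rev, ← mul_assoc, ← mul_assoc, mul_inv_cancel, one_mul]
      rw [this]; exact Mid.mul_mem (hA a' hq.2) h1
    have hss' : s' = s := hsuniq s' ⟨hq.1, hs'τ⟩
    subst hss'
    have ha' : a'⁻¹ * (s'⁻¹ * τ) ∈ H := by rwa [mul_inv_rev, mul_assoc] at hrτ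
    rw [hauniq a' ⟨hq.2, ha'⟩]

end Transversal

end Literature.NumberTheory.EllipticCurves

end
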